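import Mathlib
import HarnessLib
import Summits.AtomisticToContinuum.FouriersLaw.Theses.JunctionLocality
import Summits.AtomisticToContinuum.FouriersLaw.Theorems.JunctionLocalitySuperadditiveResistanceDeviceLiouville
import Literature.Analysis.Distribution.Hypoelliptic

/-!
# Forward fields of the γ-probed device, I: the thermostatted Liouville operator in Hörmander's form
(helper toward stub `stub_deviceForwardFields` of line `floating-probe-bypass-laplacian`,
crux stmt-AtomisticToContinuum-11748; Part I of six: `…StubDeviceForwardFieldsAux1`–`…Aux6`)

The stub asks for the EXISTENCE of the device's four terminal forward fields: classical mean-zero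
`C² ∩ L²(μ_T)` solutions of `L_dev g = −(p_s² − T)`, `L_dev = X_H + γ S_B`,
`S_B = Σ_i B_i (T∂²_{p_i} − p_i∂_{p_i})`, `B = deviceWeight` (landed `deviceGenerator_eq`). The
six helper files prove, unconditionally and for general site weights `B ≥ 0` charging site `0`
(so for the plain chain, `B = bathWeight`, as well):
* REGULARITY (Parts I–III): every weak `L¹(μ_T)` solution of `(σ X_H + c S_B + κ) g = f` (tested
  against the `μ_T`-adjoint `−σ X_H + c S_B + κ` on `C_c^∞`, `f` smooth, `σ ≠ 0`, `c > 0`) agrees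
  `μ_T`-a.e. with a smooth classical solution (`exists_classical_of_weak_gibbs`,
  `deviceForwardField_of_weak`), by Hörmander's theorem (proved in the tree) and the bracket
  condition (Part II);
* RESOLVENTS (Parts IV–VI): `λ − (σ X_H + c S_B)` is injective on `C² ∩ L²(μ_T)` for `λ > 0`
  (dissipativity, Part IV), its range on `C_c^∞` is dense and `λ‖ψ‖ ≤ ‖(λ − L)ψ‖` (Part V), hence
  for every `λ > 0` the resolvent field `g_λ = (λ − L_dev)⁻¹(p_s² − T)` exists as a smooth
  `L²(μ_T)` function (`exists_deviceResolventField`, Part VI: essential m-dissipativity).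
What is NOT proved is a bound on `‖g_λ‖_{L²(μ_T)}` uniform in `λ` — equivalently the existence
of a weak `L²(μ_T)` solution at `λ = 0` (quantitative ergodicity of the four-thermostat device:
Cuneo–Eckmann–Hairer–Rey-Bellet 2018 Thm 2.13 (3) for the network, absent from the tree).

This file: the family of vector fields whose Hörmander operator `Σ_i X_i² + X₀ + e` has formal
transpose `−σ X_H + c S_B`:
* `X₀ = σ X_H + c (0, B ⊙ p)` (Hamiltonian field `hamField` scaled by `σ` plus ANTI-friction of
  strength `c` at the weighted sites; written as the explicit term
  `fun x => σ • hamField P L x + c • (0, B * x.2)` — the file introduces NO definitions), its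
  derivative `fderiv_genDrift_apply` and divergence `fieldDiv_genDrift = c Σ_i B_i`; the constant
  fields `X_i = √(c T B_i) ∂_{p_i}` (`fun i _ => √(c T B_i) • unitP i`) and the family `(X₀; X_i)`
  over `Option (Fin L)` (`fun o => o.elim X₀ X`);
* `hormanderTranspose_gen` — **`ᵗ(Σ_i X_i² + X₀ + cΣB + κ) φ = −σ X_H φ + c S_B φ + κ φ`** for
  smooth `φ` (`κ` a constant zeroth-order term).

Bookkeeping of Cuneo–Eckmann–Hairer–Rey-Bellet, EJP 23 (2018) §3 eq. (3.2), adapted from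
`Literature/MathematicalPhysics/KineticTheory/LangevinChainHormander.lean` (`fderiv_drift_apply`,
`fieldDiv_drift`, `hormanderTranspose_eq_generator`). Axioms: `propext`, `Classical.choice`,
`Quot.sound`.
-/

noncomputable section

open MeasureTheory Filter Topology
open scoped ContDiff
open Literature.MathematicalPhysics.KineticTheory.HeatConduction
open Summit.AtomisticToContinuum.FouriersLaw.Theorems.SuperadditiveResistance.DeviceLiouville

namespace Summit.AtomisticToContinuum.FouriersLaw.Cruxes.SuperadditiveResistance.FloatingProbeBypassLaplacian

open Literature.Analysis.Distribution

variable {L : ℕ}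

/-! ## The Hörmander data of `−σ X_H + c S_B + κ` (explicit terms, NO definitions)

* `X₀ := fun x => σ • hamField P L x + c • (0, B * x.2)` — the first-order field
  `σ X_H + c (0, B ⊙ p)`;
* `X := fun i _ => √(c T B_i) • unitP i` — the constant noise fields, one per site;
* the family `fun o : Option (Fin L) => o.elim X₀ X` of `Hormander1967_thm11`. -/

variable (P : OscillatorChain)

/-! ## The drift `σ X_H + c (0, B ⊙ p)` -/

variable {P}

/-- The anti-friction field `(q, p) ↦ (0, (B_i p_i)_i)` is a continuous linear map. [folklore] -/
theorem exists_fricCLM (L : ℕ) (B : Fin L → ℝ) :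
    ∃ Λ : PhaseSpace L →L[ℝ] PhaseSpace L, ∀ x, Λ x = (((0 : Fin L → ℝ), B * x.2) : PhaseSpace L) := by
  let Λ₀ : PhaseSpace L →ₗ[ℝ] PhaseSpace L :=
    { toFun := fun x => (((0 : Fin L → ℝ), B * x.2) : PhaseSpace L)
      map_add' := fun x y => by
        ext i
        · simp
        · simp [mul_add]
      map_smul' := fun r x => by
        ext i
        · simp
        · simp only [Prod.smul_snd, Pi.mul_apply, Pi.smul_apply, smul_eq_mul, RingHom.id_apply,
            Prod.smul_mk, smul_zero]
          ring }
  exact ⟨LinearMap.toContinuousLinearMap Λ₀, fun x => rfl⟩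

/-- `X₀` is smooth for smooth potentials. [folklore] -/
theorem contDiff_genDrift (hU : ContDiff ℝ ∞ P.U) (hV : ContDiff ℝ ∞ P.V) (L : ℕ) (σ c : ℝ)
    (B : Fin L → ℝ) : ContDiff ℝ ∞ ((fun x : PhaseSpace L => σ • hamField P L x + c • (((0 : Fin L → ℝ), B * Prod.snd x) : PhaseSpace L))) := by
  obtain ⟨Λ, hΛ⟩ := exists_fricCLM L B
  have h : ((fun x : PhaseSpace L => σ • hamField P L x + c • (((0 : Fin L → ℝ), B * Prod.snd x) : PhaseSpace L))) = fun x => σ • hamField P L x + c • Λ x :=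
    funext fun x => by rw [hΛ]
  rw [h]
  exact ((contDiff_hamField P hU hV L).const_smul σ).add (Λ.contDiff.const_smul c)

/-- The noise fields are smooth (constant). [folklore] -/
theorem contDiff_genField (L : ℕ) (c T : ℝ) (B : Fin L → ℝ) (i : Fin L) :
    ContDiff ℝ ∞ ((fun (i : Fin L) (_x : PhaseSpace L) => Real.sqrt (c * T * B i) • (unitP i : PhaseSpace L)) i) :=
  contDiff_const

/-- **The derivative of the Hamiltonian field**: `DX_H(x) v = (v.2, −Hess Φ(q) v.1)`. [folklore] -/
theorem fderiv_hamField_apply (hU : ContDiff ℝ ∞ P.U) (hV : ContDiff ℝ ∞ P.V) (L : ℕ)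
    (x v : PhaseSpace L) :
    fderiv ℝ (hamField P L) x v =
      ((v.2, fun i => -(∑ j, P.hessPotential L i j x.1 * v.1 j)) : PhaseSpace L) := by
  rw [clm_apply_eq_sum]
  simp only [fderiv_hamField_unitQ P hU hV, fderiv_hamField_unitP P hU hV]
  ext i
  · simp [Prod.fst_sum, Finset.sum_apply, unitQ, Pi.single_apply]
  · simp only [Prod.snd_add, Prod.snd_sum, Prod.smul_snd, Finset.sum_apply, Pi.add_apply,
      Pi.smul_apply, smul_eq_mul, mul_neg, Finset.sum_neg_distrib, unitQ_snd, Pi.zero_apply,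
      mul_zero, Finset.sum_const_zero, add_zero]
    rw [Finset.sum_congr rfl fun j _ => mul_comm (v.1 j) (P.hessPotential L i j x.1)]

/-- **The derivative of `X₀`**: `DX₀(x) v = (σ v.2, −σ Hess Φ(q) v.1 + c B ⊙ v.2)`. [folklore] -/
theorem fderiv_genDrift_apply (hU : ContDiff ℝ ∞ P.U) (hV : ContDiff ℝ ∞ P.V) (L : ℕ)
    (σ c : ℝ) (B : Fin L → ℝ) (x v : PhaseSpace L) :
    fderiv ℝ ((fun x : PhaseSpace L => σ • hamField P L x + c • (((0 : Fin L → ℝ), B * Prod.snd x) : PhaseSpace L))) x v =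
      ((σ • v.2, fun i => -(σ * ∑ j, P.hessPotential L i j x.1 * v.1 j) + c * (B i * v.2 i)) :
        PhaseSpace L) := by
  obtain ⟨Λ, hΛ⟩ := exists_fricCLM L B
  have hd : DifferentiableAt ℝ (hamField P L) x :=
    ((contDiff_hamField P hU hV L).differentiable (by simp)) x
  have h : HasFDerivAt ((fun x : PhaseSpace L => σ • hamField P L x + c • (((0 : Fin L → ℝ), B * Prod.snd x) : PhaseSpace L))) (σ • fderiv ℝ (hamField P L) x + c • Λ) x := by
    have h1 : ((fun x : PhaseSpace L => σ • hamField P L x + c • (((0 : Fin L → ℝ), B * Prod.snd x) : PhaseSpace L))) = fun x => σ • hamField P L x + c • Λ x :=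
      funext fun x => by rw [hΛ]
    rw [h1]
    exact (hd.hasFDerivAt.const_smul σ).add (Λ.hasFDerivAt.const_smul c)
  rw [h.fderiv]
  simp only [add_apply, FunLike.coe_smul, Pi.smul_apply, fderiv_hamField_apply hU hV, hΛ]
  ext i
  · simp
  · simp only [Prod.snd_add, Prod.smul_snd, Pi.add_apply, Pi.smul_apply, Pi.mul_apply,
      smul_eq_mul]
    ring

/-- **The divergence of `X₀`** is the constant `c Σ_i B_i` (`X_H` is divergence free; only the
anti-friction contributes to `tr DX₀`). [folklore] -/
theorem fieldDiv_genDrift (hU : ContDiff ℝ ∞ P.U) (hV : ContDiff ℝ ∞ P.V) (L : ℕ) (σ c : ℝ)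
    (B : Fin L → ℝ) (x : PhaseSpace L) :
    fieldDiv ((fun x : PhaseSpace L => σ • hamField P L x + c • (((0 : Fin L → ℝ), B * Prod.snd x) : PhaseSpace L))) x = c * ∑ i, B i := by
  unfold fieldDiv
  classical
  let b := (Pi.basisFun ℝ (Fin L)).prod (Pi.basisFun ℝ (Fin L))
  rw [LinearMap.trace_eq_matrix_trace ℝ b, Matrix.trace]
  simp only [Matrix.diag_apply, LinearMap.toMatrix_apply, ContinuousLinearMap.coe_coe,
    Fintype.sum_sum_type, b, Module.Basis.prod_repr_inl, Module.Basis.prod_repr_inr,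
    Pi.basisFun_repr, Module.Basis.prod_apply, Pi.basisFun_apply, Sum.elim_inl, Sum.elim_inr,
    LinearMap.coe_inl, LinearMap.coe_inr, Function.comp_apply]
  simp only [fderiv_genDrift_apply hU hV]
  simp only [Pi.zero_apply, smul_zero, Finset.sum_const_zero, zero_add, mul_zero, neg_zero,
    Pi.single_eq_same, mul_one, Finset.mul_sum]

/-! ## The formal transpose of `Σ_i X_i² + X₀ + (c Σ B + κ)` is `−σ X_H + c S_B + κ` -/

/-- `Df(x)·(0, B ⊙ p) = Σ_i B_i p_i ∂_{p_i} f`. [folklore] -/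
theorem fderiv_apply_fric {f : PhaseSpace L → ℝ} (hf : Differentiable ℝ f) (B : Fin L → ℝ)
    (x : PhaseSpace L) :
    fderiv ℝ f x (((0 : Fin L → ℝ), B * x.2) : PhaseSpace L) = ∑ i, B i * (x.2 i * partialP i f x) := by
  rw [clm_apply_eq_sum]
  simp only [smul_eq_mul, Pi.mul_apply]
  rw [Finset.sum_eq_zero (fun j _ => by rw [Pi.zero_apply, zero_mul]), zero_add]
  refine Finset.sum_congr rfl fun i _ => ?_
  rw [partialP_eq_fderiv hf, unitP_eq]
  ring

/-- **`ᵗP φ = −σ X_H φ + c S_B φ + κ φ`** for the Hörmander operator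
`P = Σ_i X_i² + X₀ + (c Σ_i B_i + κ)` of the family `(X₀; X_i)` (`X₀ = σ X_H + c(0, B ⊙ p)`,
`X_i = √(cTB_i) ∂_{p_i}`; `κ` a constant zeroth-order term, `κ = 0` for Poisson problems,
`κ = −λ` for resolvent equations), every smooth `φ`, provided `c T B_i ≥ 0`: the operator whose
distribution kernel is tested against `−σ X_H + c S_B + κ`.
(adapted from `OscillatorChain.hormanderTranspose_eq_generator`) [folklore] -/
theorem hormanderTranspose_gen (hU : ContDiff ℝ ∞ P.U) (hV : ContDiff ℝ ∞ P.V) (L : ℕ) (σ : ℝ)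
    {c T : ℝ} {B : Fin L → ℝ} (hB : ∀ i, 0 ≤ c * T * B i) (κ : ℝ) {f : PhaseSpace L → ℝ}
    (hf : ContDiff ℝ ∞ f) (x : PhaseSpace L) :
    hormanderTranspose ((fun x : PhaseSpace L => σ • hamField P L x + c • (((0 : Fin L → ℝ), B * Prod.snd x) : PhaseSpace L))) ((fun (i : Fin L) (_x : PhaseSpace L) => Real.sqrt (c * T * B i) • (unitP i : PhaseSpace L))) (fun _ => c * (∑ i, B i) + κ) f x =
      -σ * liouvilleOp P L f x + c * bathOp L B T f x + κ * f x := by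
  have hfd : Differentiable ℝ f := hf.differentiable (by simp)
  have hfd1 : ∀ i, Differentiable ℝ (partialP i f) := fun i =>
    (contDiff_partialP hf (m := ∞) (by exact_mod_cast le_top) i).differentiable (by simp)
  rw [hormanderTranspose]
  -- second-order terms
  have hPP : ∀ i, partialP i (partialP i f) x =
      fderiv ℝ (fun y => fderiv ℝ f y (unitP i)) x (unitP i) := fun i => by
    rw [partialP_eq_fderiv (hfd1 i), partialP_eq_fderiv hfd, unitP_eq]
  have hb : ∀ i : Fin L, fieldTranspose ((fun (i : Fin L) (_x : PhaseSpace L) => Real.sqrt (c * T * B i) • (unitP i : PhaseSpace L)) i)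
      (fieldTranspose ((fun (i : Fin L) (_x : PhaseSpace L) => Real.sqrt (c * T * B i) • (unitP i : PhaseSpace L)) i) f) x = c * T * B i * partialP i (partialP i f) x :=
    fun i => by
    simp only []
    rw [fieldTranspose_fieldTranspose_const_smul _ _ hf, hPP, Real.mul_self_sqrt (hB i)]
  -- first-order term
  have h0 : fieldTranspose ((fun x : PhaseSpace L => σ • hamField P L x + c • (((0 : Fin L → ℝ), B * Prod.snd x) : PhaseSpace L))) f x =
      -(σ * liouvilleOp P L f x + c * ∑ i, B i * (x.2 i * partialP i f x)) -
        c * (∑ i, B i) * f x := by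
    rw [fieldTranspose, fieldDeriv, fieldDiv_genDrift hU hV]
    congr 1
    rw [map_add, map_smul, map_smul, ← liouvilleOp_eq_fderiv P (hU.differentiable (by simp))
      (hV.differentiable (by simp)) hfd, smul_eq_mul, smul_eq_mul, fderiv_apply_fric hfd]
  rw [Finset.sum_congr rfl fun i _ => hb i, h0]
  have hS : c * bathOp L B T f x = (∑ i, c * T * B i * partialP i (partialP i f) x) -
      c * ∑ i, B i * (x.2 i * partialP i f x) := by
    unfold bathOp
    rw [Finset.mul_sum, Finset.mul_sum, ← Finset.sum_sub_distrib]
    exact Finset.sum_congr rfl fun i _ => by ring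
  rw [hS]
  ring

/-- Registered helper sub-goal `helper_dffHormanderForm` of stub `stub_deviceForwardFields`: the Hörmander form `ᵗ(Σ X_i² + X₀ + cΣB + κ) = −σ X_H + c S_B + κ` (= `hormanderTranspose_gen` in stub form). [folklore] -/
theorem helper_dffHormanderForm : ∀ (P : OscillatorChain), ContDiff ℝ ∞ P.U → ContDiff ℝ ∞ P.V → ∀ (L : ℕ) (σ : ℝ) (c T : ℝ) (B : Fin L → ℝ), (∀ i, 0 ≤ c * T * B i) → ∀ (κ : ℝ) (f : PhaseSpace L → ℝ), ContDiff ℝ ∞ f → ∀ (x : PhaseSpace L), Literature.Analysis.Distribution.hormanderTranspose (fun x : PhaseSpace L => σ • Summit.AtomisticToContinuum.FouriersLaw.Theorems.SuperadditiveResistance.DeviceLiouville.hamField P L x + c • (((0 : Fin L → ℝ), B * Prod.snd x) : PhaseSpace L)) (fun (i : Fin L) (_x : PhaseSpace L) => Real.sqrt (c * T * B i) • (unitP i : PhaseSpace L)) (fun _ => c * (∑ i, B i) + κ) f x = -σ * Summit.AtomisticToContinuum.FouriersLaw.Theorems.SuperadditiveResistance.DeviceLiouville.liouvilleOp P L f x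 + c * Summit.AtomisticToContinuum.FouriersLaw.Theorems.SuperadditiveResistance.DeviceLiouville.bathOp L B T f x + κ * f x :=
  fun _ hU hV L σ _ _ _ hB κ _ hf x => hormanderTranspose_gen hU hV L σ hB κ hf x

end Summit.AtomisticToContinuum.FouriersLaw.Cruxes.SuperadditiveResistance.FloatingProbeBypassLaplacian

end
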